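import Literature.Topology.FourManifolds.ScaledTemplate
import Literature.Topology.FourManifolds.ChordHost
import HarnessLib

/-!
# The flat host: the host of the flip frame read on the scaled template

Topic `Literature/Topology/FourManifolds` (trunk T-4MAN). Fact seat
`provefact-Literature.Topology.FourManifolds.Knot.IsConnectedSum.isIsotopic` (Schubert's theorem),
geometric heart for rail knots, flattening step. For a flip pair `(b₁, b₂)` at a common small
scale `κ` (all scale packages bundled in `BandData.FlatHyp`), the **host** of the spiked flip frame
(`FlatHyp.host hu`, any family parameter `u ∈ [0, 1]`; the pointwise identity below is for `u = 0`) (`ExitHost.hostKnot` with `λ₀ = 1/2`, `r_A = 1/8`) is, point by point,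
the blow-down of the scaled template of `b₁` at scale `κ` (`ScaledTemplate.scaled`) read through a
**lift** `Λ̂` of the circle (`ReparamTools.IsLift`):

  `hostLoop t = ψ⁻¹ (blowDown κ (scaled σ₁ κ (Λ̂ t)))`  (`hostLoop_eq`).

The lift is the clock of the host (`ExitHost.clockFn`, extended by the ray scalars) on the native
zone and the affine image of the tip clock of `b₂` along the junction clock on the foreign zone;
the two formulas agree on the junction overlaps (`ParamGlue`), and one period on they differ by
`18` (the period of the raw template).

Everything is proved; no named facts are introduced.

## References

* M. W. Hirsch, *Differential Topology*, GTM 33 (1976), Ch. 8 §1. [HirschDT1976]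
-/

open scoped Manifold ContDiff Topology Real
open Function Set Metric Filter

noncomputable section

namespace Literature.Topology.FourManifolds

/-- Local notation: `𝔼 n` is the model Euclidean space `EuclideanSpace ℝ (Fin n)`. -/
local notation "𝔼 " n:arg => EuclideanSpace ℝ (Fin n)

/-- Local notation: `𝕊 n` is the unit sphere in `EuclideanSpace ℝ (Fin (n + 1))`. -/
local notation "𝕊 " n:arg => (Metric.sphere (0 : EuclideanSpace ℝ (Fin (n + 1))) 1)

attribute [local instance] fact_finrank_euclideanSpace_succ

open KnotsInBall ExitBend ModelTemplate

namespace BandData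

variable {A₁ B₁ K₁ : Knot} {b₁ : BandData A₁ B₁ K₁ ∅} {A₂ B₂ K₂ : Knot} {b₂ : BandData A₂ B₂ K₂ ∅}
  {hcross₁ : b₁.band ⁻¹' sphereEquator 2 ∩ squareNhd b₁.δ = {x ∈ squareNhd b₁.δ | x 0 = 2⁻¹}}
  {hcross₂ : b₂.band ⁻¹' sphereEquator 2 ∩ squareNhd b₂.δ = {x ∈ squareNhd b₂.δ | x 0 = 2⁻¹}}

/-! ### The deep track is the hairpin of the tip clock, on the whole arc domain -/

section DeepTrack

variable {A B K : Knot} {avoid : Set (𝕊 3)} (b : BandData A B K avoid)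
  {κ : ℝ} (hκ : 0 < κ) (h7 : 7 * κ ≤ b.gapLo) (h7' : 7 * κ ≤ b.gapHi)

/-- **The deep track is the hairpin of the tip clock on `[parLo (-7), parHi (-7)]`** (the version of
`ModelTemplate.deepTrack_eq_hairpin` on the whole arc domain; same proof). [folklore] -/
theorem deepTrack_eq_hairpin' {t : ℝ} (ht : t ∈ Icc (b.parLo hκ h7 neg_seven_mem) (b.parHi hκ h7' neg_seven_mem)) :
    b.deepTrack hκ h7 h7' t = hairpin (b.tipClock hκ h7 h7' t) := by
  rcases le_or_gt t (b.parLo hκ h7 five_mem) with h1 | h1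
  · have hc : t ∈ Icc (b.tcLo - b.epsLo / 8) (b.tcLo + b.epsLo / 8) :=
      ⟨le_trans (b.parLo_mem_core hκ h7 neg_seven_mem).1 ht.1, by linarith [(b.parLo_mem_core hκ h7 five_mem).2]⟩
    have ha : b.alphaLo κ t ≤ 5 := (b.alphaLo_le_iff' hκ h7 five_mem hc).2 h1
    rw [b.deepTrack_of_le hκ h7 h7' h1, b.tipClock_of_le hκ h7 h7' h1, hairpin_of_le (by linarith), levOfClockLo_clock]
  rcases lt_or_ge t (b.parHi hκ h7' five_mem) with h2 | h2
  · rw [b.deepTrack_of_mem hκ h7 h7' ⟨h1, h2⟩]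
    have hq := b.tipClock_mem hκ h7 h7' ⟨h1.le, h2.le⟩
    rcases lt_or_ge (b.tipClock hκ h7 h7' t) (3 / 8) with h3 | h3
    · exact (hairpin_eq_tip_of_mem ⟨by linarith [hq.1], h3⟩).symm
    · exact (hairpin_eq_tip_of_mem' ⟨by linarith [hq.1], by linarith [hq.2]⟩).symm
  · have hc : t ∈ Icc (b.tcHi - b.epsHi / 8) (b.tcHi + b.epsHi / 8) :=
      ⟨by linarith [(b.parHi_mem_core hκ h7' five_mem).1], le_trans ht.2 (b.parHi_mem_core hκ h7' neg_seven_mem).2⟩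
    have ha : b.alphaHi κ t ≤ 5 := (b.alphaHi_le_iff' hκ h7' five_mem hc).2 h2
    rw [b.deepTrack_of_ge hκ h7 h7' h2, b.tipClock_of_ge hκ h7 h7' h2, hairpin_of_ge (by linarith), levOfClockHi_clock]

end DeepTrack

/-! ### Flat hypotheses: all scale packages of the pair at one scale -/

variable (hcross₁ hcross₂) in
/-- **Flat hypotheses** for the pair `(b₁, b₂)` at scale `κ`: a uniform shrink scale of `b₁`, an arc
scale of `b₂`, the flip-pair relation with its pair scale, an auxiliary flatness package for the
spikes of `b₁`, and the hemisphere hypotheses. [folklore] -/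
structure FlatHyp (ε₁ r₁ A₁' ε₂ r₂ ε₁' r₁' κ : ℝ) : Prop where
  HU : b₁.ShrinkScaleU hcross₁ ε₁ r₁ A₁' κ
  arc : b₂.ArcScale hcross₂ ε₂ r₂ κ
  pair : IsFlipPair b₁ b₂
  pairScale : PairScale pair hcross₂ hcross₁ κ
  flat : b₁.IsFlat hcross₁ ε₁' r₁'
  eps_le : ε₁' ≤ 1 / 100
  five_lt : 5 * κ < r₁'
  pole : 10 * κ ≤ b₁.poleRad hcross₁
  hA : A₁.InNorth
  hB : B₁.InSouth
  hAB : Disjoint (range A₁) (range B₁)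
  hB₂ : B₂.InSouth

/-- **Flat hypotheses hold at every small scale** (for fixed auxiliary parameters). [folklore] -/
theorem exists_flatHyp (hP : IsFlipPair b₁ b₂) (hA : A₁.InNorth) (hB : B₁.InSouth) (hAB : Disjoint (range A₁) (range B₁))
    (hB₂ : B₂.InSouth) :
    ∃ ε₁ r₁ A₁' ε₂ r₂ ε₁' r₁' κ₀ : ℝ, 0 < κ₀ ∧ ∀ κ, 0 < κ → κ ≤ κ₀ → FlatHyp hcross₁ hcross₂ ε₁ r₁ A₁' ε₂ r₂ ε₁' r₁' κ := by
  obtain ⟨ε₁, r₁, A₁', k₁, hk₁, H₁⟩ := b₁.exists_shrinkScaleU (hcross := hcross₁) hB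
  obtain ⟨ε₂, r₂, k₂, hk₂, H₂⟩ := b₂.exists_arcScale hcross₂
  obtain ⟨k₃, hk₃, H₃⟩ := exists_pairScale (hcross₂ := hcross₂) (hcross₁ := hcross₁) hP
  obtain ⟨r₁', hf⟩ := b₁.exists_isFlat hcross₁ (ε := 1 / 100) (by norm_num)
  have hr := hf.r_pos
  have hp := (b₁.poleRad_pos hcross₁).1
  refine ⟨ε₁, r₁, A₁', ε₂, r₂, 1 / 100, r₁', min (min k₁ k₂) (min k₃ (min (r₁' / 6) (b₁.poleRad hcross₁ / 10))), by positivity,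
    fun κ hκ hle ↦ ?_⟩
  have h1 : κ ≤ k₁ := hle.trans ((min_le_left _ _).trans (min_le_left _ _))
  have h2 : κ ≤ k₂ := hle.trans ((min_le_left _ _).trans (min_le_right _ _))
  have h3 : κ ≤ k₃ := hle.trans ((min_le_right _ _).trans (min_le_left _ _))
  have h4 : κ ≤ r₁' / 6 := hle.trans ((min_le_right _ _).trans ((min_le_right _ _).trans (min_le_left _ _)))
  have h5 : κ ≤ b₁.poleRad hcross₁ / 10 := hle.trans ((min_le_right _ _).trans ((min_le_right _ _).trans (min_le_right _ _)))
  exact ⟨H₁ κ hκ h1, H₂ κ hκ h2, hP, H₃ κ hκ h3, hf, le_rfl, by linarith, by linarith, hA, hB, hAB, hB₂⟩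

namespace FlatHyp

variable {ε₁ r₁ A₁' ε₂ r₂ ε₁' r₁' κ : ℝ} (H : FlatHyp hcross₁ hcross₂ ε₁ r₁ A₁' ε₂ r₂ ε₁' r₁' κ)
include H

/-- Flat hypotheses at a smaller positive scale, from a family. [folklore] -/
theorem κ_pos : 0 < κ := H.HU.cone.spike.κ_pos

omit H in
/-- `1/2 ∈ (0, 1]`. [folklore] -/
theorem half_mem01 : (1 / 2 : ℝ) ∈ Ioc (0 : ℝ) 1 := ⟨by norm_num, by norm_num⟩

omit H in
/-- `0 ∈ [0, 1]`. [folklore] -/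
theorem zero_mem01 : (0 : ℝ) ∈ Icc (0 : ℝ) 1 := ⟨le_rfl, zero_le_one⟩

omit H in
/-- `1 ∈ [0, 1]`. [folklore] -/
theorem one_mem01 : (1 : ℝ) ∈ Icc (0 : ℝ) 1 := ⟨zero_le_one, le_rfl⟩

/-- **The flip frame at family parameter `u`** (the spiked flip frame of `FlipWall.lean`; `u = 0`:
reflected deep arc of `b₂` without chord, `u = 1`: with the chord). [folklore] -/
def frame (u : ℝ) : ℝ → 𝔼 4 := flipSpikedC H.arc H.HU.cone u

/-- The flip frame is a wall frame (`u ∈ [0, 1]`). [folklore] -/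
theorem isWallFrame {u : ℝ} (hu : u ∈ Icc (0 : ℝ) 1) : b₁.IsWallFrame H.HU.cone (H.frame u) :=
  isWallFrame_flipSpikedC H.arc H.pairScale H.HU.cone H.flat H.eps_le H.five_lt H.hA H.hB H.hAB H.hB₂ hu

/-- The flip frame is clear for the bend (`u ∈ [0, 1]`). [folklore] -/
theorem isBendClear {u : ℝ} (hu : u ∈ Icc (0 : ℝ) 1) : b₁.IsBendClear H.HU.cone (H.frame u) :=
  isBendClear_flipSpikedC H.arc H.pairScale H.HU.cone hu

/-- **THE HOST** of the flip frame at parameter `u` (`λ₀ = 1/2`, `r_A = 1/8`). [folklore] -/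
def host {u : ℝ} (hu : u ∈ Icc (0 : ℝ) 1) : Knot :=
  b₁.hostKnot H.HU half_mem01 (by norm_num) (H.isWallFrame hu) (rA := 1 / 8) (by norm_num) le_rfl H.hB H.hAB (H.isBendClear hu) H.hA

/-- The host loop. [folklore] -/
def hostLoop {u : ℝ} (hu : u ∈ Icc (0 : ℝ) 1) : ℝ → 𝔼 4 :=
  b₁.hostLoop H.HU half_mem01 (by norm_num) (H.isWallFrame hu) (rA := 1 / 8) (by norm_num) H.hB H.hAB

/-- The host on circle points is the host loop. [folklore] -/
theorem coe_host_circlePt {u : ℝ} (hu : u ∈ Icc (0 : ℝ) 1) (t : ℝ) : ((H.host hu (circlePt t) : 𝕊 3) : 𝔼 4) = H.hostLoop hu t :=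
  b₁.coe_hostKnot_circlePt _ _ _ _ _ _ _ _ _ _ t

/-- The host loop is a regular loop. [folklore] -/
theorem isRegularLoop_hostLoop {u : ℝ} (hu : u ∈ Icc (0 : ℝ) 1) : IsRegularLoop (H.hostLoop hu) :=
  b₁.isRegularLoop_hostLoop H.HU half_mem01 (by norm_num) (H.isWallFrame hu) (rA := 1 / 8) (by norm_num) le_rfl H.hB H.hAB

/-- The host loop is simple. [folklore] -/
theorem hostLoop_inj {u : ℝ} (hu : u ∈ Icc (0 : ℝ) 1) (s t : ℝ) (h : H.hostLoop hu s = H.hostLoop hu t) : ∃ m : ℤ, t - s = m :=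
  periodise_simple_iff.2 (b₁.injOn_hostPiece H.HU half_mem01 (by norm_num) (H.isWallFrame hu) (rA := 1 / 8) (by norm_num) le_rfl
    H.hB H.hAB (H.isBendClear hu) H.hA) s t h

/-- The host is the knot of the host loop. [folklore] -/
theorem host_eq_toKnot {u : ℝ} (hu : u ∈ Icc (0 : ℝ) 1) : H.host hu = (H.isRegularLoop_hostLoop hu).toKnot (H.hostLoop_inj hu) := rfl

/-! ### Marks -/

/-- `s⋆ = parLo₁ (-1)`: the start of the native zone (start of the period used here). [folklore] -/
def sStar : ℝ := b₁.parLo H.κ_pos H.HU.cone.spike.seven_le_gapLo neg_one_mem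

/-- `s_J = parHi₁ (-5/4)`: the switch point from the native clock to the foreign clock. [folklore] -/
def sJ : ℝ := b₁.parHi H.κ_pos H.HU.cone.spike.seven_le_gapHi neg_five_quarters_mem

/-- The native clock (`ExitHost.clockFn` at `λ₀ = 1/2`). [folklore] -/
def clock : ℝ → ℝ := b₁.clockFn H.HU half_mem01 (by norm_num : (1 / 2 : ℝ) ≤ 1 / 2)

/-- **The foreign clock**: `19/3 + (8/3)(q + 1)`, `q` the tip clock of `b₂` along the junction clock.
[folklore] -/
def pFor (t : ℝ) : ℝ :=
  19 / 3 + 8 / 3 * (b₂.tipClock H.κ_pos H.arc.seven_le_gapLo H.arc.seven_le_gapHi (theta H.HU.cone.spike H.arc t) + 1)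

/-- **The raw parameter** `Λ`: the native clock up to `s_J`, the foreign clock after. [folklore] -/
def Lam (t : ℝ) : ℝ := if t ≤ H.sJ then H.clock t else H.pFor t

/-! ### Scale facts -/

/-- `κ ≤ 1/12`. [folklore] -/
theorem κ_le : κ ≤ 1 / 12 := H.HU.cone.spike.κ_le

/-- `8κ ≤ poleRad₁`. [folklore] -/
theorem eight_le₁ : 8 * κ ≤ b₁.poleRad hcross₁ := H.HU.cone.spike.eight_le_poleRad

/-- `8κ ≤ poleRad₂`. [folklore] -/
theorem eight_le₂ : 8 * κ ≤ b₂.poleRad hcross₂ := H.arc.eight_le_poleRad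

/-- `7κ ≤ gapLo₁`. [folklore] -/
theorem h7 : 7 * κ ≤ b₁.gapLo := H.HU.cone.spike.seven_le_gapLo

/-- `7κ ≤ gapHi₁`. [folklore] -/
theorem h7' : 7 * κ ≤ b₁.gapHi := H.HU.cone.spike.seven_le_gapHi

/-- `7κ ≤ gapLo₂`. [folklore] -/
theorem g7 : 7 * κ ≤ b₂.gapLo := H.arc.seven_le_gapLo

/-- `7κ ≤ gapHi₂`. [folklore] -/
theorem g7' : 7 * κ ≤ b₂.gapHi := H.arc.seven_le_gapHi

/-! ### The marks of the period -/

/-- The lower junction (`αLo = 3/8`). [folklore] -/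
def jLo : ℝ := b₁.juncLo H.κ_pos H.h7

/-- The upper junction (`αHi = 3/8`). [folklore] -/
def jHi : ℝ := b₁.juncHi H.κ_pos H.h7'

/-- The window marks `w₁ < p₁ < p₅ < w₂` (`λ₀ = 1/2`). [folklore] -/
def w₁ : ℝ := b₁.winLo H.HU half_mem01

/-- The left collar mark. [folklore] -/
def p₁ : ℝ := b₁.collarLo H.HU half_mem01

/-- The right collar mark. [folklore] -/
def p₅ : ℝ := b₁.collarHi H.HU half_mem01

/-- The right window mark. [folklore] -/
def w₂ : ℝ := b₁.winHi H.HU half_mem01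

/-- The end of the native zone (`αHi = -1`). [folklore] -/
def nEnd : ℝ := b₁.parHi H.κ_pos H.h7' neg_one_mem

/-- The end of the upper junction overlap (`αHi = -5`). [folklore] -/
def jEnd : ℝ := b₁.parHi H.κ_pos H.h7' neg_five_mem

/-- **The marks are ordered**:
`alo < s⋆ < jLo < w₁ < p₁ < p₅ < w₂ < jHi < nEnd < sJ < jEnd < alo + 1 < s⋆ + 1`. [folklore] -/
theorem marks :
    b₁.alo < H.sStar ∧ H.sStar < H.jLo ∧ H.jLo < H.w₁ ∧ H.w₁ < H.p₁ ∧ H.p₁ < H.p₅ ∧ H.p₅ < H.w₂ ∧ H.w₂ < H.jHi ∧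
      H.jHi < H.nEnd ∧ H.nEnd < H.sJ ∧ H.sJ < H.jEnd ∧ H.jEnd < b₁.alo + 1 ∧ b₁.alo + 1 < H.sStar + 1 := by
  have hl2 : (1 / 2 : ℝ) ≤ 1 / 2 := le_rfl
  obtain ⟨c1, c2, c3⟩ := b₁.core_marks
  have hsc : H.sStar ∈ Icc (b₁.tcLo - b₁.epsLo / 8) (b₁.tcLo + b₁.epsLo / 8) := b₁.parLo_mem_core H.κ_pos H.h7 neg_one_mem
  have hjl : H.jLo ∈ Icc (b₁.tcLo - b₁.epsLo / 8) (b₁.tcLo + b₁.epsLo / 8) := b₁.juncLo_mem_core H.κ_pos H.h7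
  have hjls : b₁.alphaLo κ H.jLo = 3 / 8 := (b₁.juncLo_spec H.κ_pos H.h7).2
  have hss : b₁.alphaLo κ H.sStar = -1 := b₁.alphaLo_parLo H.κ_pos H.h7 neg_one_mem
  have hjh : H.jHi ∈ Icc (b₁.tcHi - b₁.epsHi / 8) (b₁.tcHi + b₁.epsHi / 8) := b₁.juncHi_mem_core H.κ_pos H.h7'
  have hjhs : b₁.alphaHi κ H.jHi = 3 / 8 := (b₁.juncHi_spec H.κ_pos H.h7').2
  have hw1 : H.w₁ ∈ Icc (b₁.tcLo - b₁.epsLo / 8) (b₁.tcLo + b₁.epsLo / 8) := b₁.winLo_mem_core H.HU half_mem01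
  have hw2 : H.w₂ ∈ Icc (b₁.tcHi - b₁.epsHi / 8) (b₁.tcHi + b₁.epsHi / 8) := b₁.winHi_mem_core H.HU half_mem01
  have haw1 : 3 / 8 < b₁.alphaLo κ H.w₁ := (b₁.alphaLo_clockLo_mem H.HU half_mem01 hl2 half_mem_Icc).1
  have haw2 : 3 / 8 < b₁.alphaHi κ H.w₂ := (b₁.alphaHi_clockHi_mem H.HU half_mem01 hl2 half_mem_Icc).1
  have hn : H.nEnd ∈ Icc (b₁.tcHi - b₁.epsHi / 8) (b₁.tcHi + b₁.epsHi / 8) := b₁.parHi_mem_core H.κ_pos H.h7' neg_one_mem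
  have hns : b₁.alphaHi κ H.nEnd = -1 := b₁.alphaHi_parHi H.κ_pos H.h7' neg_one_mem
  have hmono := b₁.strictMonoOn_alphaLo (κ := κ) H.κ_pos
  have hanti := b₁.strictAntiOn_alphaHi (κ := κ) H.κ_pos
  refine ⟨by linarith [hsc.1], ?_, ?_, b₁.winLo_lt_collarLo H.HU half_mem01 hl2,
    b₁.collarLo_lt_collarHi H.HU half_mem01 hl2, b₁.collarHi_lt_winHi H.HU half_mem01 hl2, ?_, ?_, ?_, ?_, ?_, by linarith [hsc.1]⟩
  · -- `s⋆ < jLo`: levels `-1 < 3/8` on the lower core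
    exact (hmono.lt_iff_lt hsc hjl).1 (by rw [hss, hjls]; norm_num)
  · -- `jLo < w₁`: levels `3/8 < αLo w₁`
    exact (hmono.lt_iff_lt hjl hw1).1 (by rw [hjls]; exact haw1)
  · -- `w₂ < jHi`: `αHi w₂ > 3/8 = αHi jHi`, `αHi` decreasing
    exact lt_of_not_ge fun h ↦ by have := hanti.antitoneOn hjh hw2 h; linarith
  · -- `jHi < nEnd`
    exact lt_of_not_ge fun h ↦ by have := hanti.antitoneOn hn hjh h; linarith
  · exact b₁.parHi_lt_parHi H.κ_pos H.h7' neg_five_quarters_mem neg_one_mem (by norm_num)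
  · exact b₁.parHi_lt_parHi H.κ_pos H.h7' neg_five_mem neg_five_quarters_mem (by norm_num)
  · have := (b₁.parHi_mem_core H.κ_pos H.h7' neg_five_mem).2; simp only [jEnd]; linarith

/-- The start of the period lies in the closed lower core. [folklore] -/
theorem sStar_mem_core : H.sStar ∈ Icc (b₁.tcLo - b₁.epsLo / 8) (b₁.tcLo + b₁.epsLo / 8) :=
  b₁.parLo_mem_core H.κ_pos H.h7 neg_one_mem

/-- The switch point lies in the closed upper core. [folklore] -/
theorem sJ_mem_core : H.sJ ∈ Icc (b₁.tcHi - b₁.epsHi / 8) (b₁.tcHi + b₁.epsHi / 8) :=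
  b₁.parHi_mem_core H.κ_pos H.h7' neg_five_quarters_mem

/-- The level at the start: `αLo s⋆ = -1`. [folklore] -/
theorem alphaLo_sStar : b₁.alphaLo κ H.sStar = -1 := b₁.alphaLo_parLo H.κ_pos H.h7 neg_one_mem

/-- The level at the switch point: `αHi sJ = -5/4`. [folklore] -/
theorem alphaHi_sJ : b₁.alphaHi κ H.sJ = -(5 / 4) := b₁.alphaHi_parHi H.κ_pos H.h7' neg_five_quarters_mem

/-! ### The two clocks agree on the upper junction overlap -/

/-- Right of `p₅` the native clock is the upper ray scalar. [folklore] -/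
theorem clock_of_p₅_le {t : ℝ} (ht : H.p₅ ≤ t) : H.clock t = b₁.psiHi κ (1 / 2) t :=
  b₁.clockFn_of_collarHi_le H.HU half_mem01 le_rfl ht

/-- Left of `p₁` the native clock is minus the lower ray scalar. [folklore] -/
theorem clock_of_le_p₁ {t : ℝ} (ht : t ≤ H.p₁) : H.clock t = -b₁.psiLo κ (1 / 2) t :=
  b₁.clockFn_of_le_collarLo H.HU half_mem01 le_rfl ht

/-- **On the upper junction overlap `[nEnd, jEnd]` the two clocks agree.** [folklore] -/
theorem clock_eq_pFor {t : ℝ} (ht : t ∈ Icc H.nEnd H.jEnd) : H.clock t = H.pFor t := by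
  have hκ := H.κ_pos
  obtain ⟨-, -, -, -, m5, m6, m7, m8, m9, m10, -, -⟩ := H.marks
  have hcore : t ∈ Icc (b₁.tcHi - b₁.epsHi / 8) (b₁.tcHi + b₁.epsHi / 8) :=
    ⟨by linarith [ht.1, (b₁.parHi_mem_core hκ H.h7' neg_one_mem).1, show H.nEnd = b₁.parHi hκ H.h7' neg_one_mem from rfl],
      le_trans ht.2 (b₁.parHi_mem_core hκ H.h7' neg_five_mem).2⟩
  -- the native clock: affine ray scalar at level `αHi t ≤ -1`
  have hα1 : b₁.alphaHi κ t ≤ -1 := (b₁.alphaHi_le_iff' hκ H.h7' neg_one_mem hcore).2 ht.1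
  have hα5 : -5 ≤ b₁.alphaHi κ t := (b₁.le_alphaHi_iff' hκ H.h7' neg_five_mem hcore).2 ht.2
  rw [H.clock_of_p₅_le (by linarith [ht.1]), psiHi, spikeScalar_of_le_seven_sixteenths _ (show b₁.alphaHi κ t ≤ 7 / 16 by linarith)]
  -- the foreign clock: `Θ = ϑ`, matched level, affine tip clock
  have hz : t ∈ Icc (b₁.parHi hκ H.h7' neg_three_quarters_mem) (b₁.parLo hκ H.h7 neg_three_quarters_mem + 1) := by
    constructor
    · exact le_trans (b₁.parHi_le_parHi hκ H.h7' neg_one_mem neg_three_quarters_mem (by norm_num)) ht.1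
    · have h1 := (b₁.parLo_mem_core hκ H.h7 neg_three_quarters_mem).1
      have h2 := (b₁.parHi_mem_core hκ H.h7' neg_five_mem).2
      have hj : H.jEnd = b₁.parHi hκ H.h7' neg_five_mem := rfl
      obtain ⟨c1, c2, c3⟩ := b₁.core_marks; linarith [ht.2]
  have hz' : t ∈ Icc (b₁.parHi hκ H.h7' neg_half_mem) (b₁.parHi hκ H.h7' neg_five_mem) :=
    ⟨le_trans (b₁.parHi_le_parHi hκ H.h7' neg_one_mem neg_half_mem (by norm_num)) ht.1, ht.2⟩
  obtain ⟨hc₂, hlev⟩ := junctionClock_lo b₁ b₂ hκ H.h7 H.h7' H.g7 H.g7' hz'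
  have hle : junctionClock b₁ b₂ hκ H.h7 H.h7' H.g7 H.g7' t ≤ b₂.parLo hκ H.g7 five_mem :=
    (b₂.alphaLo_le_iff' hκ H.g7 five_mem hc₂).1 (by rw [hlev]; linarith)
  rw [pFor, theta_eq H.HU.cone.spike H.arc hz, jc, b₂.tipClock_of_le hκ H.g7 H.g7' hle, hlev]
  ring

/-! ### Smoothness and monotonicity of the raw parameter -/

/-- The native clock is `C^∞`. [folklore] -/
theorem contDiff_clock : ContDiff ℝ ∞ H.clock := b₁.contDiff_clockFn H.HU half_mem01 le_rfl

/-- The foreign clock is `C^∞`. [folklore] -/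
theorem contDiff_pFor : ContDiff ℝ ∞ H.pFor :=
  contDiff_const.add (contDiff_const.mul (((b₂.contDiff_tipClock H.κ_pos H.g7 H.g7').comp
    (contDiff_theta H.HU.cone.spike H.arc)).add contDiff_const))

/-- Left of `sJ` the raw parameter is the native clock. [folklore] -/
theorem Lam_of_le {t : ℝ} (ht : t ≤ H.sJ) : H.Lam t = H.clock t := by simp [Lam, ht]

/-- Right of `sJ` the raw parameter is the foreign clock. [folklore] -/
theorem Lam_of_gt {t : ℝ} (ht : H.sJ < t) : H.Lam t = H.pFor t := by simp [Lam, not_le.2 ht]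

/-- On the whole overlap `[nEnd, jEnd]` the raw parameter is the native clock. [folklore] -/
theorem Lam_eq_clock_of_mem {t : ℝ} (ht : t ∈ Icc H.nEnd H.jEnd) : H.Lam t = H.clock t := by
  rcases le_or_gt t H.sJ with h | h
  · exact H.Lam_of_le h
  · rw [H.Lam_of_gt h, H.clock_eq_pFor ht]

/-- Near a point left of `jEnd` the raw parameter is eventually the native clock. [folklore] -/
theorem Lam_eventuallyEq_clock {t : ℝ} (ht : t < H.jEnd) : H.Lam =ᶠ[𝓝 t] H.clock := by
  obtain ⟨-, -, -, -, -, -, -, m8, m9, m10, -, -⟩ := H.marks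
  rcases lt_or_ge t H.sJ with h | h
  · filter_upwards [Iio_mem_nhds h] with s hs using H.Lam_of_le hs.out.le
  · filter_upwards [Ioo_mem_nhds (show H.nEnd < t by linarith) ht] with s hs using H.Lam_eq_clock_of_mem (Ioo_subset_Icc_self hs)

/-- Near a point right of `sJ` the raw parameter is eventually the foreign clock. [folklore] -/
theorem Lam_eventuallyEq_pFor {t : ℝ} (ht : H.sJ < t) : H.Lam =ᶠ[𝓝 t] H.pFor := by
  filter_upwards [Ioi_mem_nhds ht] with s hs using H.Lam_of_gt hs.out

/-- **The raw parameter is `C^∞`.** [folklore] -/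
theorem contDiff_Lam : ContDiff ℝ ∞ H.Lam := by
  obtain ⟨-, -, -, -, -, -, -, -, m9, m10, -, -⟩ := H.marks
  refine contDiff_iff_contDiffAt.2 fun t ↦ ?_
  rcases lt_or_ge t H.jEnd with h | h
  · exact H.contDiff_clock.contDiffAt.congr_of_eventuallyEq (H.Lam_eventuallyEq_clock h)
  · exact H.contDiff_pFor.contDiffAt.congr_of_eventuallyEq (H.Lam_eventuallyEq_pFor (by linarith))

/-- **Positive derivative of the native clock** on `[s⋆, jEnd]`. [folklore] -/
theorem deriv_clock_pos {t : ℝ} (ht : t ∈ Icc H.sStar H.jEnd) : 0 < deriv H.clock t := by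
  have hκ := H.κ_pos
  have hl2 : (1 / 2 : ℝ) ≤ 1 / 2 := le_rfl
  obtain ⟨m1, m2, m3, m4, m5, m6, m7, m8, m9, m10, m11, -⟩ := H.marks
  rcases lt_or_ge t H.p₁ with h1 | h1
  · -- left of the collar: `clock = -ψLo`
    have hcore : t ∈ Icc (b₁.tcLo - b₁.epsLo / 8) (b₁.tcLo + b₁.epsLo / 8) :=
      ⟨le_trans H.sStar_mem_core.1 ht.1, by linarith [(b₁.collarLo_mem_core H.HU half_mem01).2, show H.p₁ = b₁.collarLo H.HU half_mem01 from rfl]⟩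
    have hαp := (b₁.alphaLo_clockLo_mem H.HU half_mem01 hl2 three_eighths_mem_Icc).2
    have hα : b₁.alphaLo κ t < 1 := by
      have : b₁.alphaLo κ t < b₁.alphaLo κ H.p₁ :=
        b₁.strictMonoOn_alphaLo hκ hcore (b₁.collarLo_mem_core H.HU half_mem01) h1
      simp only [p₁, collarLo] at this; linarith
    obtain ⟨D, hD, hd⟩ := b₁.hasDerivAt_psiLo_neg (lam₀ := 1 / 2) half_mem01 hκ hcore hα
    have hev : H.clock =ᶠ[𝓝 t] fun s ↦ -b₁.psiLo κ (1 / 2) s := by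
      filter_upwards [Iio_mem_nhds h1] with s hs using H.clock_of_le_p₁ hs.out.le
    have hd' : HasDerivAt (fun s ↦ -b₁.psiLo κ (1 / 2) s) (-D) t := hd.neg
    rw [hev.deriv_eq, hd'.deriv]; linarith
  rcases le_or_gt t H.w₂ with h2 | h2
  · exact b₁.deriv_clockFn_pos H.HU half_mem01 hl2 (show t ∈ Icc H.w₁ H.w₂ from ⟨by linarith, h2⟩)
  · -- right of the window: `clock = ψHi`
    have hcore : t ∈ Icc (b₁.tcHi - b₁.epsHi / 8) (b₁.tcHi + b₁.epsHi / 8) :=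
      ⟨by linarith [(b₁.winHi_mem_core H.HU half_mem01).1, show H.w₂ = b₁.winHi H.HU half_mem01 from rfl],
        le_trans ht.2 (b₁.parHi_mem_core hκ H.h7' neg_five_mem).2⟩
    have hαp := (b₁.alphaHi_clockHi_mem H.HU half_mem01 hl2 half_mem_Icc).2
    have hα : b₁.alphaHi κ t < 1 := by
      have : b₁.alphaHi κ t < b₁.alphaHi κ H.w₂ :=
        b₁.strictAntiOn_alphaHi hκ (b₁.winHi_mem_core H.HU half_mem01) hcore h2
      simp only [w₂, winHi] at this; linarith
    obtain ⟨D, hD, hd⟩ := b₁.hasDerivAt_psiHi_pos (lam₀ := 1 / 2) half_mem01 hκ hcore hα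
    have hev : H.clock =ᶠ[𝓝 t] b₁.psiHi κ (1 / 2) := by
      filter_upwards [Ioi_mem_nhds (show H.p₅ < t by linarith)] with s hs using H.clock_of_p₅_le hs.out.le
    rw [hev.deriv_eq, hd.deriv]; exact hD

/-- **Positive derivative of the tip clock of `b₂` along `Θ`.** [folklore] -/
theorem deriv_tipClock_theta_pos (t : ℝ) :
    0 < deriv (b₂.tipClock H.κ_pos H.g7 H.g7') (theta H.HU.cone.spike H.arc t) := by
  have hκ := H.κ_pos
  set τ := theta H.HU.cone.spike H.arc t with hτ
  have hτm : τ ∈ Icc (b₂.parLo hκ H.g7 half_mem) (b₂.parHi hκ H.g7' half_mem) := theta_mem H.HU.cone.spike H.arc t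
  rcases lt_or_ge τ (b₂.parLo hκ H.g7 five_mem) with h1 | h1
  · -- on the lower turn: affine in `αLo₂`
    have hcore : τ ∈ Icc (b₂.tcLo - b₂.epsLo / 8) (b₂.tcLo + b₂.epsLo / 8) :=
      ⟨le_trans (b₂.parLo_mem_core hκ H.g7 half_mem).1 hτm.1, by linarith [(b₂.parLo_mem_core hκ H.g7 five_mem).2]⟩
    have hev : b₂.tipClock hκ H.g7 H.g7' =ᶠ[𝓝 τ] fun s ↦ -1 + (b₂.alphaLo κ s - 15 / 4) / 2 := by
      filter_upwards [Iio_mem_nhds h1] with s hs using b₂.tipClock_of_le hκ H.g7 H.g7' hs.out.le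
    have hd : HasDerivAt (fun s ↦ -1 + (b₂.alphaLo κ s - 15 / 4) / 2) ((deriv b₂.chiLo τ / κ) / 2) τ := by
      simpa using (((b₂.hasDerivAt_alphaLo κ τ).sub_const (15 / 4)).div_const 2).const_add (-1)
    rw [hev.deriv_eq, hd.deriv]
    exact div_pos (div_pos (b₂.deriv_chiLo_pos hcore) hκ) two_pos
  rcases le_or_gt τ (b₂.parHi hκ H.g7' five_mem) with h2 | h2
  · exact b₂.deriv_tipClock_pos hκ H.g7 H.g7' ⟨h1, h2⟩
  · have hcore : τ ∈ Icc (b₂.tcHi - b₂.epsHi / 8) (b₂.tcHi + b₂.epsHi / 8) :=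
      ⟨by linarith [(b₂.parHi_mem_core hκ H.g7' five_mem).1], le_trans hτm.2 (b₂.parHi_mem_core hκ H.g7' half_mem).2⟩
    have hev : b₂.tipClock hκ H.g7 H.g7' =ᶠ[𝓝 τ] fun s ↦ 1 - (b₂.alphaHi κ s - 15 / 4) / 2 := by
      filter_upwards [Ioi_mem_nhds h2] with s hs using b₂.tipClock_of_ge hκ H.g7 H.g7' hs.out.le
    have hd : HasDerivAt (fun s ↦ 1 - (b₂.alphaHi κ s - 15 / 4) / 2) (-((deriv b₂.chiHi τ / κ) / 2)) τ := by
      simpa using (((b₂.hasDerivAt_alphaHi κ τ).sub_const (15 / 4)).div_const 2).const_sub 1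
    rw [hev.deriv_eq, hd.deriv]
    have := div_neg_of_neg_of_pos (b₂.deriv_chiHi_neg hcore) hκ
    linarith

/-- **Positive derivative of the foreign clock** on the open clamp-identity zone. [folklore] -/
theorem deriv_pFor_pos {t : ℝ} (ht : t ∈ Ioo (b₁.parHi H.κ_pos H.h7' neg_three_quarters_mem)
    (b₁.parLo H.κ_pos H.h7 neg_three_quarters_mem + 1)) : 0 < deriv H.pFor t := by
  have hκ := H.κ_pos
  obtain ⟨hθ, hpos⟩ := hasDerivAt_theta H.HU.cone.spike H.arc ht
  have htc : HasDerivAt (b₂.tipClock hκ H.g7 H.g7') (deriv (b₂.tipClock hκ H.g7 H.g7') (theta H.HU.cone.spike H.arc t))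
      (theta H.HU.cone.spike H.arc t) :=
    (((b₂.contDiff_tipClock hκ H.g7 H.g7').differentiable (by simp)) _).hasDerivAt
  have hcomp := htc.comp t hθ
  have hd : HasDerivAt H.pFor (8 / 3 * (deriv (b₂.tipClock hκ H.g7 H.g7') (theta H.HU.cone.spike H.arc t) *
      deriv (jc H.HU.cone.spike H.arc) t)) t :=
    ((hcomp.add_const 1).const_mul (8 / 3 : ℝ)).const_add (19 / 3 : ℝ)
  rw [hd.deriv]
  exact mul_pos (by norm_num) (mul_pos (H.deriv_tipClock_theta_pos t) hpos)

/-- **THE RAW PARAMETER HAS POSITIVE DERIVATIVE ON `[s⋆, s⋆ + 1 + η]`** for some room `η > 0` to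
the right (up to `parLo₁ (-3/4) + 1`). [folklore] -/
theorem deriv_Lam_pos {t : ℝ} (ht : t ∈ Ico H.sStar (b₁.parLo H.κ_pos H.h7 neg_three_quarters_mem + 1)) :
    0 < deriv H.Lam t := by
  have hκ := H.κ_pos
  obtain ⟨m1, m2, m3, m4, m5, m6, m7, m8, m9, m10, m11, -⟩ := H.marks
  rcases lt_or_ge t H.jEnd with h | h
  · rw [(H.Lam_eventuallyEq_clock h).deriv_eq]; exact H.deriv_clock_pos ⟨ht.1, h.le⟩
  · rw [(H.Lam_eventuallyEq_pFor (by linarith)).deriv_eq]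
    refine H.deriv_pFor_pos ⟨?_, ht.2⟩
    exact lt_of_lt_of_le (b₁.parHi_lt_parHi hκ H.h7' neg_five_mem neg_three_quarters_mem (by norm_num)) h

/-- The room to the right: `s⋆ + 1 < parLo₁ (-3/4) + 1`. [folklore] -/
theorem sStar_lt : H.sStar < b₁.parLo H.κ_pos H.h7 neg_three_quarters_mem :=
  b₁.parLo_lt_parLo H.κ_pos H.h7 neg_one_mem neg_three_quarters_mem (by norm_num)

/-- **The raw parameter is strictly increasing on `[s⋆, s⋆ + 1]`.** [folklore] -/
theorem strictMonoOn_Lam : StrictMonoOn H.Lam (Icc H.sStar (H.sStar + 1)) :=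
  strictMonoOn_of_deriv_pos (convex_Icc _ _) H.contDiff_Lam.continuous.continuousOn fun t ht ↦ by
    rw [interior_Icc] at ht
    exact H.deriv_Lam_pos ⟨ht.1.le, by linarith [ht.2, H.sStar_lt]⟩

/-! ### The seam: one period on, the raw parameter grows by `18` -/

/-- **The seam identity** on `(parLo₁ (-5), parLo₁ (-3/4))` (which contains `s⋆`). [folklore] -/
theorem Lam_add_one {s : ℝ} (hs : s ∈ Ioo (b₁.parLo H.κ_pos H.h7 neg_five_mem) (b₁.parLo H.κ_pos H.h7 neg_three_quarters_mem)) :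
    H.Lam (s + 1) = H.Lam s + 18 := by
  have hκ := H.κ_pos
  obtain ⟨m1, m2, m3, m4, m5, m6, m7, m8, m9, m10, m11, -⟩ := H.marks
  have hcm := b₁.core_marks
  have h5c := b₁.parLo_mem_core hκ H.h7 neg_five_mem
  have h34c := b₁.parLo_mem_core hκ H.h7 neg_three_quarters_mem
  have hcore : s ∈ Icc (b₁.tcLo - b₁.epsLo / 8) (b₁.tcLo + b₁.epsLo / 8) := ⟨by linarith [h5c.1, hs.1], by linarith [h34c.2, hs.2]⟩
  -- left: `Λ s = -ψLo s`, affine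
  have hsJ : s ≤ H.sJ := by
    have := H.sJ_mem_core.1; linarith [hcore.2]
  have hsp : s ≤ H.p₁ := by
    have h34j : b₁.parLo hκ H.h7 neg_three_quarters_mem < H.jLo :=
      (b₁.strictMonoOn_alphaLo hκ).lt_iff_lt h34c (b₁.juncLo_mem_core hκ H.h7) |>.1
        (by rw [b₁.alphaLo_parLo hκ H.h7 neg_three_quarters_mem, (b₁.juncLo_spec hκ H.h7).2]; norm_num)
    linarith [hs.2]
  have hα34 : b₁.alphaLo κ s ≤ -(3 / 4) := ((b₁.alphaLo_le_iff' hκ H.h7 neg_three_quarters_mem hcore).2 hs.2.le)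
  have hα5 : -5 ≤ b₁.alphaLo κ s := ((b₁.le_alphaLo_iff' hκ H.h7 neg_five_mem hcore).2 hs.1.le)
  rw [H.Lam_of_le hsJ, H.clock_of_le_p₁ hsp, psiLo, spikeScalar_of_le_seven_sixteenths _ (show b₁.alphaLo κ s ≤ 7 / 16 by linarith)]
  -- right: `Λ (s + 1) = pFor (s + 1)` through the second junction
  have hgt : H.sJ < s + 1 := by linarith [hs.1, h5c.1]
  have hz : s + 1 ∈ Icc (b₁.parHi hκ H.h7' neg_three_quarters_mem) (b₁.parLo hκ H.h7 neg_three_quarters_mem + 1) := by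
    constructor
    · have := (b₁.parHi_mem_core hκ H.h7' neg_three_quarters_mem).2; linarith [hs.1, h5c.1]
    · linarith [hs.2]
  have hz' : s + 1 ∈ Icc (b₁.parLo hκ H.h7 neg_five_mem + 1) (b₁.parLo hκ H.h7 neg_half_mem + 1) :=
    ⟨by linarith [hs.1], by linarith [hs.2, b₁.parLo_le_parLo hκ H.h7 neg_three_quarters_mem neg_half_mem (by norm_num)]⟩
  obtain ⟨hc₂, hlev⟩ := junctionClock_hi b₁ b₂ hκ H.h7 H.h7' H.g7 H.g7' hz'
  rw [add_sub_cancel_right] at hlev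
  have hge : b₂.parHi hκ H.g7' five_mem ≤ junctionClock b₁ b₂ hκ H.h7 H.h7' H.g7 H.g7' (s + 1) :=
    (b₂.alphaHi_le_iff' hκ H.g7' five_mem hc₂).1 (by rw [hlev]; linarith)
  rw [H.Lam_of_gt hgt, pFor, theta_eq H.HU.cone.spike H.arc hz, jc, b₂.tipClock_of_ge hκ H.g7 H.g7' hge, hlev]
  ring

/-- The raw parameter at the start of the period is `-8/3`. [folklore] -/
theorem Lam_sStar : H.Lam H.sStar = -(8 / 3) := by
  obtain ⟨m1, m2, m3, m4, m5, m6, m7, m8, m9, m10, m11, -⟩ := H.marks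
  rw [H.Lam_of_le (by linarith), H.clock_of_le_p₁ (by linarith), psiLo, H.alphaLo_sStar,
    spikeScalar_of_le_seven_sixteenths _ (show (-1 : ℝ) ≤ 7 / 16 by norm_num)]
  norm_num

/-- `s⋆` lies in the seam zone. [folklore] -/
theorem sStar_mem_seam : H.sStar ∈ Ioo (b₁.parLo H.κ_pos H.h7 neg_five_mem) (b₁.parLo H.κ_pos H.h7 neg_three_quarters_mem) :=
  ⟨b₁.parLo_lt_parLo H.κ_pos H.h7 neg_five_mem neg_one_mem (by norm_num), H.sStar_lt⟩

/-- The raw parameter at the end of the period is `46/3`. [folklore] -/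
theorem Lam_sStar_add_one : H.Lam (H.sStar + 1) = 46 / 3 := by
  rw [H.Lam_add_one H.sStar_mem_seam, H.Lam_sStar]; norm_num

/-- **On the period the raw parameter lies in `[-8/3, 46/3]`.** [folklore] -/
theorem Lam_mem {t : ℝ} (ht : t ∈ Icc H.sStar (H.sStar + 1)) : H.Lam t ∈ Icc (-(8 / 3) : ℝ) (46 / 3) := by
  have hm := H.strictMonoOn_Lam.monotoneOn
  constructor
  · rw [← H.Lam_sStar]; exact hm ⟨le_rfl, by linarith⟩ ht ht.1
  · rw [← H.Lam_sStar_add_one]; exact hm ht ⟨by linarith, le_rfl⟩ ht.2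

/-- Right of `sJ` on the period the raw parameter is at least `3`. [folklore] -/
theorem three_le_Lam {t : ℝ} (ht : t ∈ Icc H.sJ (H.sStar + 1)) : 3 ≤ H.Lam t := by
  obtain ⟨m1, m2, m3, m4, m5, m6, m7, m8, m9, m10, m11, -⟩ := H.marks
  have h3 : H.Lam H.sJ = 3 := by
    rw [H.Lam_of_le le_rfl, H.clock_of_p₅_le (by linarith), psiHi, H.alphaHi_sJ,
      spikeScalar_of_le_seven_sixteenths _ (show (-(5 / 4) : ℝ) ≤ 7 / 16 by norm_num)]; norm_num
  rw [← h3]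
  exact H.strictMonoOn_Lam.monotoneOn ⟨by linarith, by linarith⟩ ⟨by linarith [ht.1], ht.2⟩ ht.1

/-! ### The lift -/

/-- The periodic part of the lift: `Λ / 18 - id`. [folklore] -/
def mu (t : ℝ) : ℝ := H.Lam t / 18 - t

/-- **THE LIFT** `Λ̂ = periodise s⋆ (Λ/18 - id) + id`. [folklore] -/
def lift (t : ℝ) : ℝ := periodise H.sStar H.mu t + t

/-- The seam room. [folklore] -/
def seamRoom : ℝ := min (H.sStar - b₁.parLo H.κ_pos H.h7 neg_five_mem) (b₁.parLo H.κ_pos H.h7 neg_three_quarters_mem - H.sStar)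

/-- The seam room is positive. [folklore] -/
theorem seamRoom_pos : 0 < H.seamRoom := by
  have h := H.sStar_mem_seam
  exact lt_min (by linarith [h.1]) (by linarith [h.2])

/-- The periodic part has the seam property near `s⋆`. [folklore] -/
theorem mu_seam : ∀ s ∈ Ioo (H.sStar - H.seamRoom) (H.sStar + H.seamRoom), H.mu (s + 1) = H.mu s := by
  intro s hs
  have h1 : H.seamRoom ≤ H.sStar - b₁.parLo H.κ_pos H.h7 neg_five_mem := min_le_left _ _
  have h2 : H.seamRoom ≤ b₁.parLo H.κ_pos H.h7 neg_three_quarters_mem - H.sStar := min_le_right _ _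
  simp only [mu]
  rw [H.Lam_add_one ⟨by linarith [hs.1], by linarith [hs.2]⟩]
  ring

/-- The periodic part is `C^∞`. [folklore] -/
theorem contDiff_mu : ContDiff ℝ ∞ H.mu := (H.contDiff_Lam.div_const _).sub contDiff_id

/-- **The lift is `C^∞`.** [folklore] -/
theorem contDiff_lift : ContDiff ℝ ∞ H.lift :=
  (contDiff_periodise (a := H.sStar) (F := H.mu) H.contDiff_mu H.seamRoom_pos H.mu_seam).add contDiff_id

/-- **The lift is a lift of the identity shift**: `Λ̂ (t + 1) = Λ̂ t + 1`. [folklore] -/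
theorem lift_add_one (t : ℝ) : H.lift (t + 1) = H.lift t + 1 := by
  simp only [lift]; rw [periodic_periodise]; ring

/-- **On the period the lift is `Λ / 18`.** [folklore] -/
theorem lift_eq_of_mem {t : ℝ} (ht : t ∈ Ico H.sStar (H.sStar + 1)) : H.lift t = H.Lam t / 18 := by
  simp only [lift]; rw [periodise_eq_self _ _ ht, mu]; ring

/-- **The lift has positive derivative.** [folklore] -/
theorem deriv_lift_pos (t : ℝ) : 0 < deriv H.lift t := by
  obtain ⟨n, hn, -, hd⟩ := deriv_periodise_eq (a := H.sStar) (F := H.mu) H.seamRoom_pos H.mu_seam t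
  have hmem : t - n ∈ Ico H.sStar (H.sStar + 1) := by rw [← hn]; exact toIcoMod_one_mem _ _
  have hdp : DifferentiableAt ℝ (periodise H.sStar H.mu) t :=
    ((contDiff_periodise (a := H.sStar) (F := H.mu) H.contDiff_mu H.seamRoom_pos H.mu_seam).differentiable (by simp)) t
  have e : deriv H.lift t = deriv (periodise H.sStar H.mu) t + 1 := by
    have h2 : HasDerivAt H.lift (deriv (periodise H.sStar H.mu) t + 1) t := hdp.hasDerivAt.add (hasDerivAt_id t)
    exact h2.deriv
  have hdmu : deriv H.mu (t - n) = deriv H.Lam (t - n) / 18 - 1 := by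
    have hL : HasDerivAt H.Lam (deriv H.Lam (t - n)) (t - n) := ((H.contDiff_Lam.differentiable (by simp)) _).hasDerivAt
    have hm : HasDerivAt H.mu (deriv H.Lam (t - n) / 18 - 1) (t - n) := (hL.div_const 18).sub (hasDerivAt_id (t - n))
    exact hm.deriv
  rw [e, hd, hdmu]
  have := H.deriv_Lam_pos ⟨hmem.1, by linarith [hmem.2, H.sStar_lt]⟩
  linarith

/-- **THE LIFT IS A LIFT.** [folklore] -/
theorem isLift_lift : IsLift H.lift := ⟨H.contDiff_lift, H.deriv_lift_pos, H.lift_add_one⟩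

/-- **The lift at an arbitrary parameter**: `Λ̂ t = Λ (t - n) / 18 + n` with `t - n` in the period.
[folklore] -/
theorem lift_eq (t : ℝ) : ∃ n : ℤ, t - n ∈ Ico H.sStar (H.sStar + 1) ∧ H.lift t = H.Lam (t - n) / 18 + n := by
  obtain ⟨n, hn⟩ := exists_toIcoMod_one_eq H.sStar t
  have hmem : t - n ∈ Ico H.sStar (H.sStar + 1) := by rw [← hn]; exact toIcoMod_one_mem _ _
  refine ⟨n, hmem, ?_⟩
  have := H.isLift_lift.add_int (t - n) n
  rw [sub_add_cancel] at this
  rw [this, H.lift_eq_of_mem hmem]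

/-! ### Norm bounds for the planar inputs -/

omit H in
/-- **The hairpin stays within norm `5`** for tip clocks in `[-21/8, 21/8]`. [folklore] -/
theorem norm_hairpin_le {q : ℝ} (hq : q ∈ Icc (-(21 / 8) : ℝ) (21 / 8)) : ‖hairpin q‖ ≤ 5 := by
  rcases le_or_gt q (-(3 / 8)) with h1 | h1
  · rw [hairpin_of_le h1, lowerTurn]
    have ha0 : 0 ≤ levOfClockLo q := by rw [levOfClockLo]; linarith [hq.1]
    have ha5 : levOfClockLo q ≤ 5 := by rw [levOfClockLo]; linarith
    have hV := turnV_mem ha5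
    have hX : turnX (levOfClockLo q) ∈ Icc (0 : ℝ) 4 := by
      rcases le_or_gt (levOfClockLo q) 4 with h4 | h4
      · have := turnX_mem_of_le h4; exact ⟨by linarith [this.1], this.2⟩
      · rw [turnX_of_ge h4.le]; norm_num
    refine (norm_pt2_le _ _).trans ?_
    rw [abs_of_nonneg hX.1, abs_of_nonpos (by linarith [hV.2])]; linarith [hX.2, hV.1]
  rcases lt_or_ge q (3 / 8) with h2 | h2
  · rw [hairpin_of_mem ⟨h1, h2⟩]
    refine (norm_pt2_le _ _).trans ?_
    have : |q| ≤ 3 / 8 := abs_le.2 ⟨by linarith, by linarith⟩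
    rw [abs_of_pos (by norm_num : (0 : ℝ) < 4)]; linarith
  · rw [hairpin_of_ge h2, upperTurn]
    have ha0 : 0 ≤ levOfClockHi q := by rw [levOfClockHi]; linarith [hq.2]
    have ha5 : levOfClockHi q ≤ 5 := by rw [levOfClockHi]; linarith
    have hV := turnV_mem ha5
    have hX : turnX (levOfClockHi q) ∈ Icc (0 : ℝ) 4 := by
      rcases le_or_gt (levOfClockHi q) 4 with h4 | h4
      · have := turnX_mem_of_le h4; exact ⟨by linarith [this.1], this.2⟩
      · rw [turnX_of_ge h4.le]; norm_num
    refine (norm_pt2_le _ _).trans ?_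
    rw [abs_of_nonneg hX.1, abs_neg, abs_of_nonpos (by linarith [hV.2])]; linarith [hX.2, hV.1]

/-- **The tip clock along `Θ` lies in `[-21/8, 21/8]`.** [folklore] -/
theorem tipClock_theta_mem (t : ℝ) :
    b₂.tipClock H.κ_pos H.g7 H.g7' (theta H.HU.cone.spike H.arc t) ∈ Icc (-(21 / 8) : ℝ) (21 / 8) := by
  have hκ := H.κ_pos
  set τ := theta H.HU.cone.spike H.arc t with hτ
  have hτm : τ ∈ Icc (b₂.parLo hκ H.g7 half_mem) (b₂.parHi hκ H.g7' half_mem) := theta_mem H.HU.cone.spike H.arc t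
  rcases lt_or_ge τ (b₂.parLo hκ H.g7 five_mem) with h1 | h1
  · have hcore : τ ∈ Icc (b₂.tcLo - b₂.epsLo / 8) (b₂.tcLo + b₂.epsLo / 8) :=
      ⟨le_trans (b₂.parLo_mem_core hκ H.g7 half_mem).1 hτm.1, by linarith [(b₂.parLo_mem_core hκ H.g7 five_mem).2]⟩
    have ha1 : 1 / 2 ≤ b₂.alphaLo κ τ := (b₂.le_alphaLo_iff' hκ H.g7 half_mem hcore).2 hτm.1
    have ha5 : b₂.alphaLo κ τ ≤ 5 := (b₂.alphaLo_le_iff' hκ H.g7 five_mem hcore).2 h1.le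
    rw [b₂.tipClock_of_le hκ H.g7 H.g7' h1.le]
    constructor <;> linarith
  rcases le_or_gt τ (b₂.parHi hκ H.g7' five_mem) with h2 | h2
  · have := b₂.tipClock_mem hκ H.g7 H.g7' ⟨h1, h2⟩
    exact ⟨by linarith [this.1], by linarith [this.2]⟩
  · have hcore : τ ∈ Icc (b₂.tcHi - b₂.epsHi / 8) (b₂.tcHi + b₂.epsHi / 8) :=
      ⟨by linarith [(b₂.parHi_mem_core hκ H.g7' five_mem).1], le_trans hτm.2 (b₂.parHi_mem_core hκ H.g7' half_mem).2⟩
    have ha1 : 1 / 2 ≤ b₂.alphaHi κ τ := (b₂.le_alphaHi_iff' hκ H.g7' half_mem hcore).2 hτm.2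
    have ha5 : b₂.alphaHi κ τ ≤ 5 := (b₂.alphaHi_le_iff' hκ H.g7' five_mem hcore).2 h2.le
    rw [b₂.tipClock_of_ge hκ H.g7 H.g7' h2.le]
    constructor <;> linarith

/-- `Θ` takes values in `[parLo₂ (-7), parHi₂ (-7)]`. [folklore] -/
theorem theta_mem7 (t : ℝ) :
    theta H.HU.cone.spike H.arc t ∈ Icc (b₂.parLo H.κ_pos H.g7 neg_seven_mem) (b₂.parHi H.κ_pos H.g7' neg_seven_mem) :=
  Ioo_subset_Icc_self (theta_mem_Ioo H.HU.cone.spike H.arc t)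

/-! ### Band quotients at the true scale -/

/-- The band quotient of a neck point `(α, v)`, `|α| ≤ 2`, `|v| ≤ 1`, is the blow-up of the band
point. [folklore] -/
theorem bandQuot_pt2 {α v : ℝ} (hα : |α| ≤ 2) (hv : |v| ≤ 1) :
    b₁.bandQuot hcross₁ κ (pt2 α v) = b₁.blowUp hcross₁ κ (b₁.Fband (κ • pt2 α v)) := by
  have hκ := H.κ_pos
  refine b₁.bandQuot_of_ne_zero hcross₁ hκ.ne' ?_
  rw [norm_smul, Real.norm_eq_abs, abs_of_pos hκ]
  have h1 := norm_pt2_le α v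
  have h2 := H.pole
  nlinarith

/-- The band quotient of a flipped hairpin point is the blow-up of the band point. [folklore] -/
theorem bandQuot_neg_hairpin {q : ℝ} (hq : q ∈ Icc (-(21 / 8) : ℝ) (21 / 8)) :
    b₁.bandQuot hcross₁ κ (-hairpin q) = b₁.blowUp hcross₁ κ (b₁.Fband (κ • -hairpin q)) := by
  have hκ := H.κ_pos
  refine b₁.bandQuot_of_ne_zero hcross₁ hκ.ne' ?_
  rw [norm_smul, Real.norm_eq_abs, abs_of_pos hκ, norm_neg]
  have h1 := norm_hairpin_le hq
  have h2 := H.pole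
  nlinarith

omit H in
/-- The blow-up of an affine combination. [folklore] -/
theorem blowUp_lineComb (κ w : ℝ) (y z : 𝔼 3) :
    b₁.blowUp hcross₁ κ ((1 - w) • y + w • z) = (1 - w) • b₁.blowUp hcross₁ κ y + w • b₁.blowUp hcross₁ κ z := by
  simp only [blowUp]
  have e : (1 - w) • y + w • z - b₁.pZero = (1 - w) • (y - b₁.pZero) + w • (z - b₁.pZero) := by module
  rw [e, map_add, map_smul, map_smul, smul_add, smul_comm κ⁻¹ (1 - w), smul_comm κ⁻¹ w]

/-- **The blow-up of the spiked lower piece at `u = 1` is the scaled lower piece** (`|α| ≤ 2`).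
[folklore] -/
theorem blowUp_pieceLo {α : ℝ} (hα : |α| ≤ 2) :
    b₁.blowUp hcross₁ κ (b₁.pieceLo hcross₁ κ b₁.depthSign 1 α) = b₁.lowerPiece hcross₁ b₁.depthSign κ α := by
  rw [pieceLo, one_mul, blowUp_lineComb, b₁.blowUp_blowDown hcross₁ H.κ_pos.ne', b₁.railLoPsi_eq_Fband_smul,
    ← H.bandQuot_pt2 hα (by norm_num), lowerPiece]

/-- **The blow-up of the spiked upper piece at `u = 1` is the scaled upper piece** (`|α| ≤ 2`).
[folklore] -/
theorem blowUp_pieceHi {α : ℝ} (hα : |α| ≤ 2) :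
    b₁.blowUp hcross₁ κ (b₁.pieceHi hcross₁ κ b₁.depthSign 1 α) = b₁.upperPiece hcross₁ b₁.depthSign κ α := by
  rw [pieceHi, one_mul, blowUp_lineComb, b₁.blowUp_blowDown hcross₁ H.κ_pos.ne', b₁.railHiPsi_eq_Fband_smul,
    ← H.bandQuot_pt2 hα (by norm_num), upperPiece]

/-! ### The bent knot and the frame -/

omit H in
/-- `0 < 1/8`. [folklore] -/
theorem eighth_pos : (0 : ℝ) < 1 / 8 := by norm_num

/-- The bent knot of the flip frame (`λ₀ = 1/2`, `r_A = 1/8`). [folklore] -/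
def bent {u : ℝ} (hu : u ∈ Icc (0 : ℝ) 1) : Knot := b₁.bentKnot H.HU (H.isWallFrame hu) half_mem01 eighth_pos H.hB H.hAB

/-- **Off the open collar, on the fundamental domain, the host loop is the bent knot.** [folklore] -/
theorem hostLoop_eq_bent {u : ℝ} (hu : u ∈ Icc (0 : ℝ) 1) {t : ℝ} (ht : t ∈ Ico b₁.alo (b₁.alo + 1)) (hc : t ∉ Ioo H.p₁ H.p₅) :
    H.hostLoop hu t = ((H.bent hu (circlePt t) : 𝕊 3) : 𝔼 4) :=
  b₁.hostLoop_of_not_mem_collar H.HU half_mem01 le_rfl (H.isWallFrame hu) eighth_pos le_rfl H.hB H.hAB ht hc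

/-- **On the window the host loop is the straight piece.** [folklore] -/
theorem hostLoop_window {u : ℝ} (hu : u ∈ Icc (0 : ℝ) 1) {t : ℝ} (ht : t ∈ Icc H.w₁ H.w₂) :
    H.hostLoop hu t = ((psiN.symm (b₁.blowDown hcross₁ κ (cO b₁.depthSign + H.clock t • dLo b₁.depthSign)) : 𝕊 3) : 𝔼 4) :=
  b₁.hostLoop_of_mem_window H.HU half_mem01 le_rfl (H.isWallFrame hu) eighth_pos le_rfl H.hB H.hAB ht

/-- The content set is `[jLo, jHi]`. [folklore] -/
theorem contentSet_eq : b₁.contentSet H.κ_pos H.h7 H.h7' = Icc H.jLo H.jHi := rfl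

/-- **Off the content set the bent knot is the frame.** [folklore] -/
theorem coe_bent_of_not_mem {u : ℝ} (hu : u ∈ Icc (0 : ℝ) 1) {t : ℝ} (ht : t ∈ Ico b₁.alo (b₁.alo + 1)) (hts : t ∉ Icc H.jLo H.jHi) :
    ((H.bent hu (circlePt t) : 𝕊 3) : 𝔼 4) = H.frame u t :=
  b₁.bentKnot_circlePt_of_not_mem H.HU (H.isWallFrame hu) (H.isBendClear hu) H.hA half_mem01 eighth_pos H.hB H.hAB ht hts

/-- **On the extended native zone `[parLo₁ (-7/2), sJ]` the frame is the spiked piece function.**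
[folklore] -/
theorem frame_eq_spikePiece (u : ℝ) {t : ℝ} (ht : t ∈ Icc (b₁.parLo H.κ_pos H.h7 neg_seven_halves_mem) H.sJ) :
    H.frame u t = b₁.spikePiece hcross₁ κ b₁.depthSign 1 t := by
  rw [frame, flipSpikedC]
  exact b₁.spikeFam_of_eq hcross₁ κ b₁.depthSign 1 (flipBase_eq_neckPiece H.HU.cone.spike H.arc H.pair ht)

/-- Right of `nEnd` nothing is in the support of the spikes. [folklore] -/
theorem not_mem_spikeSupp_of_gt {t : ℝ} (ht : H.nEnd < t) : t ∉ b₁.spikeSupp κ := by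
  have hκ := H.κ_pos
  have hcm := b₁.core_marks
  have hn := b₁.parHi_mem_core hκ H.h7' neg_one_mem
  rintro (⟨hc, hα⟩ | ⟨hc, hα⟩)
  · have : H.nEnd = b₁.parHi hκ H.h7' neg_one_mem := rfl
    linarith [hc.2, hn.1]
  · have h1 : b₁.alphaHi κ t < -1 := (b₁.alphaHi_lt_iff' hκ H.h7' neg_one_mem hc).2 ht
    linarith [hα.1]

/-- Left of `s⋆` nothing is in the support of the spikes. [folklore] -/
theorem not_mem_spikeSupp_of_lt {t : ℝ} (ht : t < H.sStar) : t ∉ b₁.spikeSupp κ := by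
  have hκ := H.κ_pos
  have hcm := b₁.core_marks
  have hs := H.sStar_mem_core
  rintro (⟨hc, hα⟩ | ⟨hc, hα⟩)
  · have h1 : b₁.alphaLo κ t < -1 := (b₁.alphaLo_lt_iff' hκ H.h7 neg_one_mem hc).2 ht
    linarith [hα.1]
  · linarith [hc.1, hs.2]

/-- **Right of `nEnd` the frame is the reflected deep arc of `b₂` through `Θ`.** [folklore] -/
theorem frame_of_gt (u : ℝ) {t : ℝ} (ht : H.nEnd < t) : H.frame u t = foreignPt H.HU.cone.spike H.arc u (theta H.HU.cone.spike H.arc t) := by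
  rw [frame, flipSpikedC, b₁.spikeFam_of_not_mem H.HU.cone.spike _ 1 (H.not_mem_spikeSupp_of_gt ht), flipBase_of_gt _ _ ht]

/-- **Left of `s⋆` the frame is the reflected deep arc of `b₂` through `Θ (t + 1)`.** [folklore] -/
theorem frame_of_lt (u : ℝ) {t : ℝ} (ht : t < H.sStar) :
    H.frame u t = foreignPt H.HU.cone.spike H.arc u (theta H.HU.cone.spike H.arc (t + 1)) := by
  rw [frame, flipSpikedC, b₁.spikeFam_of_not_mem H.HU.cone.spike _ 1 (H.not_mem_spikeSupp_of_lt ht), flipBase_of_lt _ _ ht]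

/-- **The reflected deep arc of `b₂` at `u = 0`, read in the chart of `b₁`**: the band point of
`b₁` at the flipped hairpin. [folklore] -/
theorem foreignPt_zero_eq (t : ℝ) :
    foreignPt H.HU.cone.spike H.arc 0 (theta H.HU.cone.spike H.arc t) =
      ((psiN.symm (b₁.Fband (κ • -hairpin (b₂.tipClock H.κ_pos H.g7 H.g7' (theta H.HU.cone.spike H.arc t)))) : 𝕊 3) : 𝔼 4) := by
  have hκ := H.κ_pos
  set τ := theta H.HU.cone.spike H.arc t with hτ
  set q := b₂.tipClock hκ H.g7 H.g7' τ with hq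
  have hqm : q ∈ Icc (-(21 / 8) : ℝ) (21 / 8) := H.tipClock_theta_mem t
  have hn : ‖κ • -hairpin q‖ < 8 * κ := by
    rw [norm_smul, Real.norm_eq_abs, abs_of_pos hκ, norm_neg]
    have := norm_hairpin_le hqm; nlinarith
  have e : b₂.arcChart hκ H.g7 H.g7' 0 τ = b₂.Fband (-(κ • -hairpin q)) := by
    rw [b₂.arcChart_zero hκ H.g7 H.g7' (H.theta_mem7 t), b₂.deepTrack_eq_hairpin' hκ H.g7 H.g7' (H.theta_mem7 t),
      smul_neg, neg_neg]
  rw [foreignPt, e, ← H.pair.psiN_symm_Fband_eq (hcross₂ := hcross₂) (hcross₁ := hcross₁) (lt_of_lt_of_le hn H.eight_le₂)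
    (lt_of_lt_of_le hn H.eight_le₁)]

/-! ### Bounds on the ray scalar -/

omit H in
/-- For `α ∈ [3/8, 3/4]` the ray scalar at `λ₀ = 1/2` lies in `[1/6, 5/6]`. [folklore] -/
theorem spikeScalar_mem {α : ℝ} (hα : α ∈ Icc (3 / 8 : ℝ) (3 / 4)) : spikeScalar (1 * (1 - 1 / 2)) α ∈ Icc (1 / 6 : ℝ) (5 / 6) := by
  have hw := smoothStep_mem_Icc (7 / 16) (11 / 16) α
  rw [spikeScalar, spikeWin]
  set w := smoothStep (7 / 16) (11 / 16) α
  have hf1 : 1 / 3 ≤ 1 - (α - 1 / 4) / (3 / 4) := by rw [sub_div]; linarith [hα.2]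
  have hf2 : 1 - (α - 1 / 4) / (3 / 4) ≤ 5 / 6 := by linarith [hα.1]
  constructor <;> nlinarith [hw.1, hw.2]

/-! ### The zones of the period -/

/-- A parameter of `[s⋆, sJ]` lies in the fundamental domain. [folklore] -/
theorem mem_Ico_of_mem {t : ℝ} (ht : t ∈ Icc H.sStar H.sJ) : t ∈ Ico b₁.alo (b₁.alo + 1) := by
  obtain ⟨m1, -, -, -, -, -, -, -, -, m10, m11, -⟩ := H.marks
  exact ⟨by linarith [ht.1], by linarith [ht.2]⟩

/-- **Zone 1** `[s⋆, jLo)`: lower neck and blend. [folklore] -/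
theorem hostLoop_eq_zone1 {u : ℝ} (hu : u ∈ Icc (0 : ℝ) 1) {t : ℝ} (ht : t ∈ Ico H.sStar H.jLo) :
    H.hostLoop hu t = ((psiN.symm (b₁.blowDown hcross₁ κ (b₁.scaledRaw hcross₁ b₁.depthSign κ (H.Lam t))) : 𝕊 3) : 𝔼 4) := by
  have hκ := H.κ_pos
  obtain ⟨m1, m2, m3, m4, m5, m6, m7, m8, m9, m10, m11, -⟩ := H.marks
  have hI : t ∈ Ico b₁.alo (b₁.alo + 1) := H.mem_Ico_of_mem (t := t) ⟨ht.1, by linarith [ht.2]⟩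
  have hjl : H.jLo ∈ Icc (b₁.tcLo - b₁.epsLo / 8) (b₁.tcLo + b₁.epsLo / 8) := b₁.juncLo_mem_core hκ H.h7
  have hcore : t ∈ Icc (b₁.tcLo - b₁.epsLo / 8) (b₁.tcLo + b₁.epsLo / 8) := ⟨le_trans H.sStar_mem_core.1 ht.1, by linarith [ht.2, hjl.2]⟩
  have hmono := b₁.strictMonoOn_alphaLo (κ := κ) hκ
  have hα1 : -1 ≤ b₁.alphaLo κ t := by rw [← H.alphaLo_sStar]; exact hmono.monotoneOn H.sStar_mem_core hcore ht.1
  have hα2 : b₁.alphaLo κ t < 3 / 8 := by rw [← (b₁.juncLo_spec hκ H.h7).2]; exact hmono hcore hjl ht.2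
  have hαabs : |b₁.alphaLo κ t| ≤ 2 := abs_le.2 ⟨by linarith, by linarith⟩
  -- the host: bent knot off the content = frame = spiked lower piece
  rw [H.hostLoop_eq_bent hu hI (fun h ↦ by linarith [h.1, ht.2]), H.coe_bent_of_not_mem hu hI (fun h ↦ by linarith [h.1, ht.2]),
    H.frame_eq_spikePiece u ⟨le_trans (b₁.parLo_le_parLo hκ H.h7 neg_seven_halves_mem neg_one_mem (by norm_num)) ht.1, by linarith [ht.2]⟩,
    b₁.spikePiece_coreLo hcross₁ hκ H.κ_le H.eight_le₁ b₁.depthSign 1 hcore (lt_of_le_of_lt hαabs (by norm_num)), spikePtLo]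
  -- the parameter
  have hL : H.Lam t = -(1 - 4 / 3 * (b₁.alphaLo κ t - 1 / 4)) := by
    rw [H.Lam_of_le (by linarith [ht.2]), H.clock_of_le_p₁ (by linarith [ht.2]), psiLo,
      spikeScalar_of_le_seven_sixteenths _ (show b₁.alphaLo κ t ≤ 7 / 16 by linarith)]
  have hp : H.Lam t ≤ -(3 / 4) := by rw [hL]; linarith
  have hlev : levLoOfP (H.Lam t) = b₁.alphaLo κ t := by rw [hL, levLoOfP]; ring
  congr 2
  rw [← b₁.blowDown_blowUp hcross₁ hκ.ne' (b₁.pieceLo hcross₁ κ b₁.depthSign 1 _), H.blowUp_pieceLo hαabs,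
    b₁.scaledRaw_of_le' hcross₁ hp, hlev]

/-- **Zone 2** `[jLo, w₁]`: the lower straight ray. [folklore] -/
theorem hostLoop_eq_zone2 {u : ℝ} (hu : u ∈ Icc (0 : ℝ) 1) {t : ℝ} (ht : t ∈ Icc H.jLo H.w₁) :
    H.hostLoop hu t = ((psiN.symm (b₁.blowDown hcross₁ κ (b₁.scaledRaw hcross₁ b₁.depthSign κ (H.Lam t))) : 𝕊 3) : 𝔼 4) := by
  have hκ := H.κ_pos
  have hl2 : (1 / 2 : ℝ) ≤ 1 / 2 := le_rfl
  obtain ⟨m1, m2, m3, m4, m5, m6, m7, m8, m9, m10, m11, -⟩ := H.marks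
  have hI : t ∈ Ico b₁.alo (b₁.alo + 1) := H.mem_Ico_of_mem (t := t) ⟨by linarith [ht.1], by linarith [ht.2]⟩
  have hjl : H.jLo ∈ Icc (b₁.tcLo - b₁.epsLo / 8) (b₁.tcLo + b₁.epsLo / 8) := b₁.juncLo_mem_core hκ H.h7
  have hw1 : H.w₁ ∈ Icc (b₁.tcLo - b₁.epsLo / 8) (b₁.tcLo + b₁.epsLo / 8) := b₁.winLo_mem_core H.HU half_mem01
  have hcore : t ∈ Icc (b₁.tcLo - b₁.epsLo / 8) (b₁.tcLo + b₁.epsLo / 8) := ⟨by linarith [ht.1, hjl.1], by linarith [ht.2, hw1.2]⟩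
  have hmono := b₁.strictMonoOn_alphaLo (κ := κ) hκ
  have hα1 : 3 / 8 ≤ b₁.alphaLo κ t := by rw [← (b₁.juncLo_spec hκ H.h7).2]; exact hmono.monotoneOn hjl hcore ht.1
  have hα2 : b₁.alphaLo κ t < 3 / 4 := by
    have := (b₁.alphaLo_clockLo_mem H.HU half_mem01 hl2 half_mem_Icc).2
    exact lt_of_le_of_lt (hmono.monotoneOn hcore hw1 ht.2) this
  have hψ := spikeScalar_mem ⟨hα1, hα2.le⟩
  rw [H.hostLoop_eq_bent hu hI (fun h ↦ by linarith [h.1, ht.2]), bent,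
    b₁.bentKnot_circlePt_lowerSpike H.HU (H.isWallFrame hu) half_mem01 eighth_pos H.hB H.hAB hcore ⟨hα1, hα2.le⟩,
    b₁.rayLo_eq_blowDown H.HU, H.Lam_of_le (by linarith [ht.2]), H.clock_of_le_p₁ (by linarith [ht.2]), psiLo,
    b₁.scaledRaw_of_mem_seg' hcross₁ ⟨by linarith [hψ.2], by linarith [hψ.1]⟩]

/-- **Zone 3** `[w₁, w₂]`: the window. [folklore] -/
theorem hostLoop_eq_zone3 {u : ℝ} (hu : u ∈ Icc (0 : ℝ) 1) {t : ℝ} (ht : t ∈ Icc H.w₁ H.w₂) :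
    H.hostLoop hu t = ((psiN.symm (b₁.blowDown hcross₁ κ (b₁.scaledRaw hcross₁ b₁.depthSign κ (H.Lam t))) : 𝕊 3) : 𝔼 4) := by
  obtain ⟨m1, m2, m3, m4, m5, m6, m7, m8, m9, m10, m11, -⟩ := H.marks
  have hc : H.clock t ∈ Icc (-(1 / 2) : ℝ) (1 / 2) := b₁.clockFn_mem H.HU half_mem01 le_rfl ht
  rw [H.hostLoop_window hu ht, H.Lam_of_le (by linarith [ht.2]), b₁.scaledRaw_of_mem_seg' hcross₁ ⟨by linarith [hc.1], hc.2⟩]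

/-- **Zone 4** `(w₂, jHi]`: the bent upper ray. [folklore] -/
theorem hostLoop_eq_zone4 {u : ℝ} (hu : u ∈ Icc (0 : ℝ) 1) {t : ℝ} (ht : t ∈ Ioc H.w₂ H.jHi) :
    H.hostLoop hu t = ((psiN.symm (b₁.blowDown hcross₁ κ (b₁.scaledRaw hcross₁ b₁.depthSign κ (H.Lam t))) : 𝕊 3) : 𝔼 4) := by
  have hκ := H.κ_pos
  have hl2 : (1 / 2 : ℝ) ≤ 1 / 2 := le_rfl
  obtain ⟨m1, m2, m3, m4, m5, m6, m7, m8, m9, m10, m11, -⟩ := H.marks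
  have hI : t ∈ Ico b₁.alo (b₁.alo + 1) := H.mem_Ico_of_mem (t := t) ⟨by linarith [ht.1], by linarith [ht.2]⟩
  have hjh : H.jHi ∈ Icc (b₁.tcHi - b₁.epsHi / 8) (b₁.tcHi + b₁.epsHi / 8) := b₁.juncHi_mem_core hκ H.h7'
  have hw2 : H.w₂ ∈ Icc (b₁.tcHi - b₁.epsHi / 8) (b₁.tcHi + b₁.epsHi / 8) := b₁.winHi_mem_core H.HU half_mem01
  have hcore : t ∈ Icc (b₁.tcHi - b₁.epsHi / 8) (b₁.tcHi + b₁.epsHi / 8) := ⟨by linarith [ht.1, hw2.1], by linarith [ht.2, hjh.2]⟩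
  have hanti := b₁.strictAntiOn_alphaHi (κ := κ) hκ
  have hα1 : 3 / 8 ≤ b₁.alphaHi κ t := by rw [← (b₁.juncHi_spec hκ H.h7').2]; exact hanti.antitoneOn hcore hjh ht.2
  have hαw : b₁.alphaHi κ H.w₂ < 3 / 4 := (b₁.alphaHi_clockHi_mem H.HU half_mem01 hl2 half_mem_Icc).2
  have hα2 : b₁.alphaHi κ t < 3 / 4 := lt_of_lt_of_le' hαw (hanti.antitoneOn hw2 hcore ht.1.le)
  have hψ := spikeScalar_mem ⟨hα1, hα2.le⟩
  have hhalf : b₁.psiHi κ (1 / 2) H.w₂ < b₁.psiHi κ (1 / 2) t := b₁.psiHi_lt_psiHi H.HU half_mem01 hw2 hcore ht.1 (by linarith)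
  have hw : b₁.psiHi κ (1 / 2) H.w₂ = 1 / 2 := (b₁.clockHi_spec H.HU half_mem01 half_mem_Icc).2
  rw [hw, psiHi] at hhalf
  rw [H.hostLoop_eq_bent hu hI (fun h ↦ by linarith [h.2, ht.1]), bent,
    b₁.bentKnot_circlePt_upperSpike H.HU (H.isWallFrame hu) half_mem01 eighth_pos H.hB H.hAB hcore ⟨hα1, hα2.le⟩,
    H.Lam_of_le (by linarith [ht.2]), H.clock_of_p₅_le (by linarith [ht.1]), psiHi,
    b₁.scaledRaw_of_mem_arc hcross₁ ⟨by linarith [hhalf], by linarith [hψ.2]⟩]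

/-- **Zone 5** `(jHi, sJ]`: upper blend and neck. [folklore] -/
theorem hostLoop_eq_zone5 {u : ℝ} (hu : u ∈ Icc (0 : ℝ) 1) {t : ℝ} (ht : t ∈ Ioc H.jHi H.sJ) :
    H.hostLoop hu t = ((psiN.symm (b₁.blowDown hcross₁ κ (b₁.scaledRaw hcross₁ b₁.depthSign κ (H.Lam t))) : 𝕊 3) : 𝔼 4) := by
  have hκ := H.κ_pos
  obtain ⟨m1, m2, m3, m4, m5, m6, m7, m8, m9, m10, m11, -⟩ := H.marks
  have hI : t ∈ Ico b₁.alo (b₁.alo + 1) := H.mem_Ico_of_mem (t := t) ⟨by linarith [ht.1], ht.2⟩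
  have hjh : H.jHi ∈ Icc (b₁.tcHi - b₁.epsHi / 8) (b₁.tcHi + b₁.epsHi / 8) := b₁.juncHi_mem_core hκ H.h7'
  have hcore : t ∈ Icc (b₁.tcHi - b₁.epsHi / 8) (b₁.tcHi + b₁.epsHi / 8) := ⟨by linarith [ht.1, hjh.1], le_trans ht.2 H.sJ_mem_core.2⟩
  have hanti := b₁.strictAntiOn_alphaHi (κ := κ) hκ
  have hα1 : b₁.alphaHi κ t < 3 / 8 := by rw [← (b₁.juncHi_spec hκ H.h7').2]; exact hanti hjh hcore ht.1
  have hα2 : -(5 / 4) ≤ b₁.alphaHi κ t := by rw [← H.alphaHi_sJ]; exact hanti.antitoneOn hcore H.sJ_mem_core ht.2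
  have hαabs : |b₁.alphaHi κ t| ≤ 2 := abs_le.2 ⟨by linarith, by linarith⟩
  have hss : H.sStar = b₁.parLo H.κ_pos H.h7 neg_one_mem := rfl
  have h72 := b₁.parLo_le_parLo H.κ_pos H.h7 neg_seven_halves_mem neg_one_mem (by norm_num)
  rw [H.hostLoop_eq_bent hu hI (fun h ↦ by linarith [h.2, ht.1]), H.coe_bent_of_not_mem hu hI (fun h ↦ by linarith [h.2, ht.1]),
    H.frame_eq_spikePiece u ⟨by linarith [ht.1], ht.2⟩,
    b₁.spikePiece_coreHi hcross₁ hκ H.κ_le H.eight_le₁ b₁.depthSign 1 hcore (lt_of_le_of_lt hαabs (by norm_num)), spikePtHi]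
  have hL : H.Lam t = 1 - 4 / 3 * (b₁.alphaHi κ t - 1 / 4) := by
    rw [H.Lam_of_le ht.2, H.clock_of_p₅_le (by linarith [ht.1]), psiHi,
      spikeScalar_of_le_seven_sixteenths _ (show b₁.alphaHi κ t ≤ 7 / 16 by linarith)]
  have hp : H.Lam t ∈ Icc (5 / 6 : ℝ) 6 := by rw [hL]; constructor <;> linarith
  have hlev : levHiOfP (H.Lam t) = b₁.alphaHi κ t := by rw [hL, levHiOfP]; ring
  congr 2
  rw [← b₁.blowDown_blowUp hcross₁ hκ.ne' (b₁.pieceHi hcross₁ κ b₁.depthSign 1 _), H.blowUp_pieceHi hαabs,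
    b₁.scaledRaw_of_mem_upper hcross₁ hp, hlev]

/-- **Zone 6 at `u = 0`** `(sJ, s⋆ + 1)`: the foreign zone (through the seam of the fundamental
domain). [folklore] -/
theorem hostLoop_eq_zone6 {t : ℝ} (ht : t ∈ Ioo H.sJ (H.sStar + 1)) :
    H.hostLoop zero_mem01 t = ((psiN.symm (b₁.blowDown hcross₁ κ (b₁.scaledRaw hcross₁ b₁.depthSign κ (H.Lam t))) : 𝕊 3) : 𝔼 4) := by
  have hκ := H.κ_pos
  obtain ⟨m1, m2, m3, m4, m5, m6, m7, m8, m9, m10, m11, -⟩ := H.marks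
  -- the host is the reflected arc through `Θ t` in both sub-cases
  have hval : H.hostLoop zero_mem01 t = foreignPt H.HU.cone.spike H.arc 0 (theta H.HU.cone.spike H.arc t) := by
    rcases lt_or_ge t (b₁.alo + 1) with h | h
    · have hI : t ∈ Ico b₁.alo (b₁.alo + 1) := ⟨by linarith [ht.1], h⟩
      rw [H.hostLoop_eq_bent zero_mem01 hI (fun h' ↦ by linarith [h'.2, ht.1]),
        H.coe_bent_of_not_mem zero_mem01 hI (fun h' ↦ by linarith [h'.2, ht.1]), H.frame_of_gt 0 (by linarith [ht.1])]
    · have hI : t - 1 ∈ Ico b₁.alo (b₁.alo + 1) := ⟨by linarith, by linarith [ht.2]⟩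
      have hper := (H.isRegularLoop_hostLoop zero_mem01).periodic
      rw [show t = t - 1 + 1 by ring, hper, H.hostLoop_eq_bent zero_mem01 hI (fun h' ↦ by linarith [h'.1, ht.2]),
        H.coe_bent_of_not_mem zero_mem01 hI (fun h' ↦ by linarith [h'.1, ht.2]), H.frame_of_lt 0 (by linarith [ht.2]), sub_add_cancel]
  rw [hval, H.foreignPt_zero_eq t]
  -- the parameter
  set q := b₂.tipClock hκ H.g7 H.g7' (theta H.HU.cone.spike H.arc t) with hq
  have hL : H.Lam t = 19 / 3 + 8 / 3 * (q + 1) := H.Lam_of_gt ht.1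
  have h3 : 3 ≤ H.Lam t := H.three_le_Lam ⟨ht.1.le, ht.2.le⟩
  have hqq : qOfP (H.Lam t) = q := by rw [hL, qOfP]; ring
  congr 2
  rw [b₁.scaledRaw_of_ge hcross₁ (by linarith), hqq, foreignPiece, H.bandQuot_neg_hairpin (H.tipClock_theta_mem t),
    b₁.blowDown_blowUp hcross₁ hκ.ne']

/-- **THE HOST LOOP AT `u = 0` ON THE PERIOD `[s⋆, s⋆ + 1)`.** [folklore] -/
theorem hostLoop_eq_of_mem {t : ℝ} (ht : t ∈ Ico H.sStar (H.sStar + 1)) :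
    H.hostLoop zero_mem01 t = ((psiN.symm (b₁.blowDown hcross₁ κ (b₁.scaledRaw hcross₁ b₁.depthSign κ (H.Lam t))) : 𝕊 3) : 𝔼 4) := by
  rcases lt_or_ge t H.jLo with h1 | h1
  · exact H.hostLoop_eq_zone1 zero_mem01 ⟨ht.1, h1⟩
  rcases le_or_gt t H.w₁ with h2 | h2
  · exact H.hostLoop_eq_zone2 zero_mem01 ⟨h1, h2⟩
  rcases le_or_gt t H.w₂ with h3 | h3
  · exact H.hostLoop_eq_zone3 zero_mem01 ⟨h2.le, h3⟩
  rcases le_or_gt t H.jHi with h4 | h4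
  · exact H.hostLoop_eq_zone4 zero_mem01 ⟨h3, h4⟩
  rcases le_or_gt t H.sJ with h5 | h5
  · exact H.hostLoop_eq_zone5 zero_mem01 ⟨h4, h5⟩
  · exact H.hostLoop_eq_zone6 ⟨h5, ht.2⟩

/-- **THE HOST LOOP AT `u = 0` IS THE BLOWN-DOWN SCALED TEMPLATE ALONG THE LIFT.** [folklore] -/
theorem hostLoop_eq (t : ℝ) :
    H.hostLoop zero_mem01 t = ((psiN.symm (b₁.blowDown hcross₁ κ (b₁.scaled hcross₁ b₁.depthSign κ (H.lift t))) : 𝕊 3) : 𝔼 4) := by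
  obtain ⟨n, hmem, hl⟩ := H.lift_eq t
  have hper := (H.isRegularLoop_hostLoop zero_mem01).periodic
  have e1 : H.hostLoop zero_mem01 t = H.hostLoop zero_mem01 (t - n) := by
    have := (hper.int_mul n).sub_eq t
    simpa using this.symm
  have hL := H.Lam_mem (Ico_subset_Icc_self hmem)
  have e2 : b₁.scaled hcross₁ b₁.depthSign κ (H.lift t) = b₁.scaledRaw hcross₁ b₁.depthSign κ (H.Lam (t - n)) := by
    rw [hl, scaled, periodise_add_int, ← scaled, b₁.scaled_eq' hcross₁ ⟨by linarith [hL.1], by linarith [hL.2]⟩]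
    congr 1; ring
  rw [e1, e2, H.hostLoop_eq_of_mem hmem]

end FlatHyp

end BandData

end Literature.Topology.FourManifolds
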